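import Mathlib.Analysis.Calculus.Deriv.Shift
import Literature.Analysis.FunctionSpaces.TorusSpaceTime
import Literature.Analysis.FunctionSpaces.TorusTestFunction
import Literature.Analysis.FluidPDE.LerayHopf
import Literature.Analysis.FluidPDE.CheskidovTotalDissipation
import Literature.Analysis.FluidPDE.EulerReynolds
import Literature.Analysis.FluidPDE.PassiveScalarProofs
import HarnessLib

/-!
# Torus bookkeeping for classical force constructions: `L^p` in time, scalar cutoffs, body forces

Analysis/FluidPDE support file (all proved, [folklore]) collecting the small torus lemmas used by
the §6 periodisation step of Cheskidov, arXiv:2311.04182 (2023), Thm. 1.3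
(`CheskidovCutoffs` … `CheskidovPeriodisation`), none of which is specific to that paper:

* `L^p` norms on the probability space `T^d` are bounded by sup norms
  (`Torus.eLpNorm_le_of_forall_norm_le`); jointly smooth fields are continuous in time with
  values in `L^p` (`Torus.IsSmoothSpaceTimeOn.continuousInLpOn`, tube lemma); sums and continuous
  scalar multiples of `C(S; L^p)` fields (`Torus.ContinuousInLpOn.add`, `.smul_continuousOn`);
* `Δ(c • f) = c • Δf`, `Δ0 = 0`, constant multiples of divergence-free / mean-zero fields
  (the `∇`/`div` versions are reused from `PassiveScalarProofs` / `EulerReynolds`); the product rule `∂ₜ(c(t) u(t,x)) = c' u + c ∂ₜu` and the two-sided slice derivative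
  of a jointly smooth field at interior times;
* the advection–diffusion residual `Torus.adResidual ν V R = ∂ₜR + V·∇R - νΔR` (vertical
  component of the `2½`-dimensional force, Cheskidov 2023 (6.6)–(6.7));
* the Navier–Stokes body force `Torus.nsBodyForce` (`CheskidovTotalDissipation`) of a mean-zero
  divergence-free smooth field is mean zero (`Torus.hasZeroMean_nsBodyForce`: `∫∂ₜv = d/dt∫v`,
  `∫(v·∇)v = 0`, `∫Δv = 0`) and of a periodic field is periodic (`Torus.periodic_nsBodyForce`).

## References

* A. Cheskidov, arXiv:2311.04182 (2023), §6, (6.6)–(6.7) (the residual `h^m`).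
-/

open MeasureTheory Set Filter Topology Function
open scoped ENNReal InnerProductSpace ContDiff

noncomputable section

namespace Literature.Analysis.FluidPDE

namespace Torus

variable {d : Type*} [Fintype d]
variable {F : Type*} [NormedAddCommGroup F] [NormedSpace ℝ F]

/-! ## `L^p` bookkeeping on the probability space `T^d` -/

omit [NormedSpace ℝ F] in
/-- On the probability space `T^d`, `‖f‖_{L^p} ≤ C` as soon as `‖f(x)‖ ≤ C` for all `x`
(Mathlib `eLpNorm_le_of_ae_bound` with `volume univ = 1`). [folklore] -/
theorem eLpNorm_le_of_forall_norm_le {f : UnitAddTorus d → F} {C : ℝ} (h : ∀ x, ‖f x‖ ≤ C)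
    (p : ℝ≥0∞) : eLpNorm f p volume ≤ ENNReal.ofReal C := by
  have h1 := eLpNorm_le_of_ae_bound (p := p) (μ := (volume : Measure (UnitAddTorus d)))
    (Eventually.of_forall h)
  simpa using h1

/-- **Jointly smooth fields are continuous in time with values in `L^p`** (on any time set `S`;
tube lemma over the compact torus: `u s → u t` uniformly, and `volume` is a probability
measure). [folklore] -/
theorem _root_.Literature.Analysis.FunctionSpaces.Torus.IsSmoothSpaceTimeOn.continuousInLpOn
    {S : Set ℝ} {u : ℝ → UnitAddTorus d → F} (hu : FunctionSpaces.Torus.IsSmoothSpaceTimeOn S u)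
    (p : ℝ≥0∞) : ContinuousInLpOn S p u := by
  refine ⟨fun t ht => (hu.isSmooth_slice ht).memLp p, fun t₀ ht₀ => ?_⟩
  rw [ENNReal.tendsto_nhds_zero]
  intro ε hε
  rcases eq_or_ne ε ⊤ with hε' | hε'
  · exact Eventually.of_forall fun t => hε'.symm ▸ le_top
  have hεr : 0 < ε.toReal := ENNReal.toReal_pos hε.ne' hε'
  filter_upwards [hu.eventually_norm_sub_lt ht₀ hεr] with t ht
  calc eLpNorm (u t - u t₀) p volume ≤ ENNReal.ofReal ε.toReal :=
        eLpNorm_le_of_forall_norm_le (fun x => (ht x).le) p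
    _ = ε := ENNReal.ofReal_toReal hε'

omit [NormedSpace ℝ F] in
/-- Sums of `C(S; L^p)` fields are `C(S; L^p)` (`1 ≤ p`). [folklore] -/
theorem ContinuousInLpOn.add {S : Set ℝ} {p : ℝ≥0∞} (hp : 1 ≤ p) {u w : ℝ → UnitAddTorus d → F}
    (hu : ContinuousInLpOn S p u) (hw : ContinuousInLpOn S p w) :
    ContinuousInLpOn S p (fun t x => u t x + w t x) := by
  refine ⟨fun t ht => (hu.1 t ht).add (hw.1 t ht), fun t₀ ht₀ => ?_⟩
  have h := (hu.2 t₀ ht₀).add (hw.2 t₀ ht₀)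
  rw [add_zero] at h
  refine tendsto_of_tendsto_of_tendsto_of_le_of_le' tendsto_const_nhds h
    (Eventually.of_forall fun t => zero_le) ?_
  filter_upwards [self_mem_nhdsWithin] with t ht
  have heq : (fun x => u t x + w t x) - (fun x => u t₀ x + w t₀ x) = (u t - u t₀) + (w t - w t₀) := by
    funext x; simp only [Pi.sub_apply, Pi.add_apply]; abel
  rw [heq]
  exact eLpNorm_add_le ((hu.1 t ht).1.sub (hu.1 t₀ ht₀).1) ((hw.1 t ht).1.sub (hw.1 t₀ ht₀).1) hp

/-- A `C(S; L^p)` field times a continuous scalar function of time is `C(S; L^p)`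
(`‖c(t)u(t) - c(t₀)u(t₀)‖ ≤ |c(t)| ‖u(t) - u(t₀)‖ + |c(t) - c(t₀)| ‖u(t₀)‖`). [folklore] -/
theorem ContinuousInLpOn.smul_continuousOn {S : Set ℝ} {p : ℝ≥0∞} (hp : 1 ≤ p)
    {u : ℝ → UnitAddTorus d → F} (hu : ContinuousInLpOn S p u) {c : ℝ → ℝ} (hc : ContinuousOn c S) :
    ContinuousInLpOn S p (fun t x => c t • u t x) := by
  refine ⟨fun t ht => (hu.1 t ht).const_smul (c t), fun t₀ ht₀ => ?_⟩
  have hu0 : eLpNorm (u t₀) p volume < ⊤ := (hu.1 t₀ ht₀).2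
  -- `|c t| ≤ |c t₀| + 1` eventually
  have hcb : ∀ᶠ t in 𝓝[S] t₀, ‖c t‖ ≤ ‖c t₀‖ + 1 := by
    have h := (hc t₀ ht₀).norm
    have : ∀ᶠ t in 𝓝[S] t₀, ‖c t‖ < ‖c t₀‖ + 1 :=
      h.eventually (gt_mem_nhds (by linarith))
    exact this.mono fun t ht => ht.le
  have hc0 : Tendsto (fun t => ENNReal.ofReal ‖c t - c t₀‖ * eLpNorm (u t₀) p volume) (𝓝[S] t₀) (𝓝 0) := by
    have h1 : Tendsto (fun t => ‖c t - c t₀‖) (𝓝[S] t₀) (𝓝 0) := by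
      have := (((hc t₀ ht₀).sub (continuousWithinAt_const (b := c t₀))).norm).tendsto
      simpa using this
    have h2 : Tendsto (fun t => ENNReal.ofReal ‖c t - c t₀‖) (𝓝[S] t₀) (𝓝 0) := by
      have h := (ENNReal.continuous_ofReal.tendsto 0).comp h1
      rw [ENNReal.ofReal_zero] at h
      exact h
    simpa using ENNReal.Tendsto.mul_const h2 (Or.inr hu0.ne)
  have hmain : Tendsto (fun t => ENNReal.ofReal (‖c t₀‖ + 1) * eLpNorm (u t - u t₀) p volume +
      ENNReal.ofReal ‖c t - c t₀‖ * eLpNorm (u t₀) p volume) (𝓝[S] t₀) (𝓝 0) := by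
    have h1 := ENNReal.Tendsto.const_mul (hu.2 t₀ ht₀) (a := ENNReal.ofReal (‖c t₀‖ + 1))
      (Or.inr ENNReal.ofReal_ne_top)
    rw [mul_zero] at h1
    simpa using h1.add hc0
  refine tendsto_of_tendsto_of_tendsto_of_le_of_le' tendsto_const_nhds hmain
    (Eventually.of_forall fun t => zero_le) ?_
  filter_upwards [hcb, self_mem_nhdsWithin] with t hct ht
  have heq : (fun x => c t • u t x) - (fun x => c t₀ • u t₀ x) =
      c t • (u t - u t₀) + (c t - c t₀) • u t₀ := by
    funext x; simp only [Pi.sub_apply, Pi.add_apply, Pi.smul_apply, smul_sub, sub_smul]; abel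
  rw [heq]
  have hA : eLpNorm (c t • (u t - u t₀)) p volume ≤
      ENNReal.ofReal (‖c t₀‖ + 1) * eLpNorm (u t - u t₀) p volume := by
    rw [eLpNorm_const_smul (c t) (u t - u t₀) p volume, ← ofReal_norm]
    gcongr
  have hB : eLpNorm ((c t - c t₀) • u t₀) p volume =
      ENNReal.ofReal ‖c t - c t₀‖ * eLpNorm (u t₀) p volume := by
    rw [eLpNorm_const_smul (c t - c t₀) (u t₀) p volume, ← ofReal_norm]
  calc eLpNorm (c t • (u t - u t₀) + (c t - c t₀) • u t₀) p volume
      ≤ eLpNorm (c t • (u t - u t₀)) p volume + eLpNorm ((c t - c t₀) • u t₀) p volume :=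
        eLpNorm_add_le (((hu.1 t ht).1.sub (hu.1 t₀ ht₀).1).const_smul _)
          ((hu.1 t₀ ht₀).1.const_smul _) hp
    _ ≤ ENNReal.ofReal (‖c t₀‖ + 1) * eLpNorm (u t - u t₀) p volume +
          ENNReal.ofReal ‖c t - c t₀‖ * eLpNorm (u t₀) p volume := add_le_add hA hB.le

/-! ## Linearity in a scalar factor; product rule in time -/

/-- `Δ(c • f) = c • Δf` for smooth functions on the torus, `c • f` the `Pi` scalar multiple
(Mathlib `InnerProductSpace.laplacian_smul` on the re-centred lift; the primed name distinguishes it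
from the `fun y => c • Ψ y` form `Torus.laplacian_const_smul` of `LerayHopfTimeSliceTorus`, whose
heavy import chain is not wanted here). [folklore] -/
theorem laplacian_const_smul' {f : UnitAddTorus d → F} (hf : FunctionSpaces.Torus.IsSmooth f) (c : ℝ)
    (x : UnitAddTorus d) :
    FunctionSpaces.Torus.laplacian (c • f) x = c • FunctionSpaces.Torus.laplacian f x := by
  unfold FunctionSpaces.Torus.laplacian
  rw [show FunctionSpaces.Torus.liftAt (c • f) x = c • FunctionSpaces.Torus.liftAt f x from rfl]
  exact InnerProductSpace.laplacian_smul c ((hf.liftAt x).contDiffAt.of_le (by norm_cast))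

/-- `Δ0 = 0` on the torus (the zero function written as `fun _ => 0`, matching
`Torus.gradient_zero` / `Torus.divergence_zero` of `EulerReynolds`). [folklore] -/
@[simp]
theorem laplacian_zero (x : UnitAddTorus d) :
    FunctionSpaces.Torus.laplacian (fun _ : UnitAddTorus d => (0 : F)) x = 0 := by
  have h := laplacian_const_smul' (f := fun _ : UnitAddTorus d => (0 : F))
    (FunctionSpaces.Torus.isSmooth_const _) 0 x
  rw [zero_smul, zero_smul] at h
  exact h

/-- The **advection–diffusion residual** `∂ₜR + V·∇R - νΔR` of a planar pair (time derivative
within `univ`); it is the vertical component of the `2½`-dimensional Navier–Stokes force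
(Cheskidov 2023, (6.6)–(6.7): `h^m = ∂ₜθ^m + v^m·∇θ^m - ν_m Δθ^m`). [cite: Cheskidov2023, (6.6)–(6.7)] -/
def adResidual (ν : ℝ) (V : ℝ → UnitAddTorus d → EuclideanSpace ℝ d) (R : ℝ → UnitAddTorus d → ℝ)
    (t : ℝ) (y : UnitAddTorus d) : ℝ :=
  FunctionSpaces.Torus.timeDerivWithin univ R t y + ⟪V t y, FunctionSpaces.Torus.gradient (R t) y⟫_ℝ -
    ν * FunctionSpaces.Torus.laplacian (R t) y

/-- Unfolding `adResidual`. [cite: Cheskidov2023, (6.6)–(6.7)] -/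
theorem adResidual_apply (ν : ℝ) (V : ℝ → UnitAddTorus d → EuclideanSpace ℝ d)
    (R : ℝ → UnitAddTorus d → ℝ) (t : ℝ) (y : UnitAddTorus d) :
    adResidual ν V R t y = FunctionSpaces.Torus.timeDerivWithin univ R t y +
      ⟪V t y, FunctionSpaces.Torus.gradient (R t) y⟫_ℝ - ν * FunctionSpaces.Torus.laplacian (R t) y :=
  rfl

/-- Constant multiples of `C¹` divergence-free fields are divergence free. [folklore] -/
theorem isDivFree_const_smul [DecidableEq d] {v : UnitAddTorus d → EuclideanSpace ℝ d}
    (hv : FunctionSpaces.Torus.IsContDiff 1 v) (hdiv : FunctionSpaces.Torus.IsDivFree v) (c : ℝ) :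
    FunctionSpaces.Torus.IsDivFree (c • v) := fun x => by
  rw [divergence_const_smul hv, hdiv x, mul_zero]

omit [NormedSpace ℝ F] in
/-- Constant multiples of mean-zero fields are mean zero. [folklore] -/
theorem hasZeroMean_const_smul [NormedSpace ℝ F] {f : UnitAddTorus d → F}
    (hf : FunctionSpaces.Torus.HasZeroMean f) (c : ℝ) : FunctionSpaces.Torus.HasZeroMean (c • f) := by
  unfold FunctionSpaces.Torus.HasZeroMean at hf ⊢
  simp [integral_smul, hf]

omit [Fintype d] in
/-- **Product rule in time for a scalar cutoff**: if the slice `s ↦ u s x` is differentiable at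
`t` (e.g. `u` jointly smooth on a time set containing `t` in its interior) and `c` is
differentiable at `t`, then `∂ₜ(c • u)(t, x) = c'(t) u(t, x) + c(t) ∂ₜu(t, x)` (two-sided, within
`univ`). [folklore] -/
theorem timeDerivWithin_univ_smul {u : ℝ → UnitAddTorus d → F} {c : ℝ → ℝ} {t : ℝ} {x : UnitAddTorus d}
    {u' : F} {c' : ℝ} (hu : HasDerivAt (fun s => u s x) u' t) (hc : HasDerivAt c c' t) :
    FunctionSpaces.Torus.timeDerivWithin univ (fun s y => c s • u s y) t x = c' • u t x + c t • u' := by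
  rw [FunctionSpaces.Torus.timeDerivWithin, derivWithin_univ]
  have h : HasDerivAt (fun s => c s • u s x) (c t • u' + c' • u t x) t := hc.smul hu
  rw [h.deriv, add_comm]

/-- Two-sided time derivative of a jointly smooth field at an interior time, as a `HasDerivAt`
statement for the slice. [folklore] -/
theorem _root_.Literature.Analysis.FunctionSpaces.Torus.IsSmoothSpaceTimeOn.hasDerivAt_slice
    {S : Set ℝ} {u : ℝ → UnitAddTorus d → F} (hu : FunctionSpaces.Torus.IsSmoothSpaceTimeOn S u)
    {t : ℝ} (ht : t ∈ interior S) (x : UnitAddTorus d) :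
    HasDerivAt (fun s => u s x) (FunctionSpaces.Torus.timeDerivWithin S u t x) t :=
  (hu.hasDerivWithinAt_slice (interior_subset ht) x).hasDerivAt (mem_interior_iff_mem_nhds.1 ht)

/-! ## Means and periodicity of the Navier–Stokes body force -/

/-- The time derivative of a field that is mean zero at all times is mean zero (smooth on
`ℝ × T^d`; differentiate `t ↦ ∫ u(t) = 0` under the integral). [folklore] -/
theorem hasZeroMean_timeDerivWithin_univ {u : ℝ → UnitAddTorus d → F}
    (hu : FunctionSpaces.Torus.IsSmoothSpaceTimeOn univ u) (h0 : ∀ t, FunctionSpaces.Torus.HasZeroMean (u t))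
    (t : ℝ) : FunctionSpaces.Torus.HasZeroMean (FunctionSpaces.Torus.timeDerivWithin univ u t) := by
  have h := (hu.hasDerivWithinAt_integral convex_univ (mem_univ t)).hasDerivAt univ_mem
  have hc : (fun s => ∫ x, u s x) = fun _ => (0 : F) := funext fun s => h0 s
  rw [hc] at h
  exact ((hasDerivAt_const t (0 : F)).unique h).symm

/-- `∫_{T^d} Δf = 0` for smooth vector-valued `f` (each `∫ ∂ᵢ∂ᵢ f = 0`; the vector-valued
variant of the scalar `Torus.integral_laplacian_eq_zero` of `PassiveScalarEnergyProofs`). [folklore] -/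
theorem integral_laplacian_eq_zero' [DecidableEq d] {f : UnitAddTorus d → F}
    (hf : FunctionSpaces.Torus.IsSmooth f) : ∫ x, FunctionSpaces.Torus.laplacian f x = 0 := by
  simp_rw [FunctionSpaces.Torus.laplacian_eq_sum_partialDeriv_partialDeriv hf]
  rw [integral_finsetSum _ fun i _ => ((hf.partialDeriv i).partialDeriv i).integrable]
  exact Finset.sum_eq_zero fun i _ =>
    FunctionSpaces.Torus.integral_partialDeriv_eq_zero_holds (hf.partialDeriv i) i

/-- **The Navier–Stokes body force of a mean-zero divergence-free smooth field is mean zero**: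
`∫ (∂ₜv + (v·∇)v - νΔv) = d/dt ∫ v + ∫ (v·∇)v - ν ∫ Δv = 0` (Cheskidov 2023, §6: the forces
of Thm. 1.3 are mean zero). [folklore] -/
theorem hasZeroMean_nsBodyForce [DecidableEq d] {ν : ℝ} {v : ℝ → UnitAddTorus d → EuclideanSpace ℝ d}
    (hv : FunctionSpaces.Torus.IsSmoothSpaceTimeOn univ v) (hdiv : ∀ t, FunctionSpaces.Torus.IsDivFree (v t))
    (h0 : ∀ t, FunctionSpaces.Torus.HasZeroMean (v t)) (t : ℝ) :
    FunctionSpaces.Torus.HasZeroMean (nsBodyForce ν v t) := by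
  have hvt : FunctionSpaces.Torus.IsSmooth (v t) := hv.isSmooth_slice (mem_univ t)
  unfold FunctionSpaces.Torus.HasZeroMean
  simp only [nsBodyForce_apply]
  rw [integral_sub, integral_add, integral_smul]
  · rw [hasZeroMean_timeDerivWithin_univ hv h0 t]
    unfold FunctionSpaces.Torus.convect
    rw [FunctionSpaces.Torus.integral_fderiv_apply_eq_zero_of_isDivFree hvt hvt (hdiv t),
      integral_laplacian_eq_zero' hvt]
    simp
  · exact ((hv.timeDerivWithin uniqueDiffOn_univ).isSmooth_slice (mem_univ t)).integrable
  · exact (hvt.convect hvt).integrable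
  · exact (((hv.timeDerivWithin uniqueDiffOn_univ).isSmooth_slice (mem_univ t)).add
      (hvt.convect hvt)).integrable
  · exact (show FunctionSpaces.Torus.IsSmooth (ν • FunctionSpaces.Torus.laplacian (v t)) from
      hvt.laplacian.const_smul ν).integrable

/-- **The body force of a time-periodic field is time-periodic** (time derivative within `univ`
of a periodic function is periodic, `deriv_comp_add_const`). [folklore] -/
theorem periodic_nsBodyForce {ν τ : ℝ} {v : ℝ → UnitAddTorus d → EuclideanSpace ℝ d}
    (hv : Periodic v τ) : Periodic (nsBodyForce ν v) τ := fun t => by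
  have hd : FunctionSpaces.Torus.timeDerivWithin univ v (t + τ) =
      FunctionSpaces.Torus.timeDerivWithin univ v t := by
    funext y
    simp only [FunctionSpaces.Torus.timeDerivWithin, derivWithin_univ]
    rw [← deriv_comp_add_const (fun s => v s y) τ t]
    simp only [hv _]
  funext x
  simp only [nsBodyForce_apply, hd, hv t]

end Torus

end Literature.Analysis.FluidPDE

end
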